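import Summits.AtomisticToContinuum.HydrodynamicLimit.Theorems.JaynesSqueezeHardSphereLDAApprox
import Summits.AtomisticToContinuum.HydrodynamicLimit.Theorems.JaynesSqueezeBlockGibbsMeasurableProfiles
import Summits.AtomisticToContinuum.HydrodynamicLimit.Theorems.RelayRaceLocalityNearConstantShortTimeHLEntropyToLLN
import Summits.AtomisticToContinuum.HydrodynamicLimit.Theorems.CollisionIsometryCLTHsFreeEnergyConvexBasic
import HarnessLib

/-!
# General-family free energy of the canonical hard-sphere gas: the diameter sandwich

Support file for the crux `…Theses.RelayRaceLocality.NearConstantShortTimeHL` (stmt-AtomisticToContinuum-12502),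
line `means-pin-entropy`, stub `stub_ldaGeneralFamilies : GeneralFamilyLDA` (S1 (i): the pressure per particle
`n_N⁻¹ log Z_N` of `n_N` hard spheres of diameter `ε_N` on `𝕋³` in a slowly varying activity, for a GENERAL
admissible family `ε_N → 0`, `n_N ε_N³ → σ³`). The tree's statics (cluster expansion, `HardSphereEulerRatio/LLN`;
local density approximation, `JaynesSqueezeHardSphereLDA*`) is written along the CONJUNCT family
`(hsDiameter σ N, N + 1) = (σ (N+1)^{-1/3}, N + 1)`. This file transfers conjunct-family free-energy limits to
general families by an elementary MONOTONICITY SANDWICH: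

* `posPartition_antitone_diam` — the configurational partition function `Z(a, ε, n) = ∫ 𝟙_{no overlap at ε} ∏ a(xᵢ)`
  is antitone in the diameter `ε` (the non-overlap set shrinks, `HsFreeEnergyConvex.posDomain_anti`);
* `posPartition_le_exp_mul_posPartition` — and `e^{nB}`-Lipschitz in `log a`:
  `Z(a') ≤ e^{nB} Z(a)` when `|log a' − log a| ≤ B` (monotonicity in the activity, `posPartition_mono`);
* `eventually_hsDiameter_le_le` — for `σ₋ < σ < σ₊`, eventually `σ₋ n_N^{-1/3} ≤ ε_N ≤ σ₊ n_N^{-1/3}`, i.e. the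
  `N`-th general system is squeezed between the conjunct systems of INDEX `n_N − 1` at reduced diameters `σ±`;
* `tendsto_log_posPartition_of_conjunct` — **THE DIAMETER SANDWICH**: if along the conjunct family
  `(N+1)⁻¹ log Z(a_{σ'}, hsDiameter σ' N, N+1) → L(σ')` for every `σ'` near `σ`, for a family of activities
  `a_{σ'}` with `log a_{σ'} → log a_σ` uniformly and `L` continuous at `σ`, then
  `n_N⁻¹ log Z(a_σ, ε_N, n_N) → L(σ)` for every admissible general family (`n_N → ∞` by
  `tendsto_atTop_of_tendsto_mul_pow_three`, subsequence `N ↦ n_N − 1` of the conjunct limits at `σ±`, and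
  `e^{∓ n B}` from the activity comparison; then `σ± → σ`).

No definitions; the conjunct-family limit is a HYPOTHESIS here (it is discharged, for thermodynamic activities
of dilute continuous densities, by the local density approximation of item 13459).
References: E. Pulvirenti – D. Tsagkarogiannis, Comm. Math. Phys. 316 (2012) Thm 2.1; D. Ruelle, *Statistical
Mechanics* (1969) §3.4 (monotonicity of hard-core partition functions in the core).
-/

noncomputable section

namespace Summit.AtomisticToContinuum.HydrodynamicLimit.Theorems.NearConstantShortTimeHL

open scoped BigOperators ENNReal Topology
open MeasureTheory Set Filter
open Literature.MathematicalPhysics.KineticTheory Literature.Analysis.FluidPDE Literature.Analysis.FunctionSpaces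
open Summit.AtomisticToContinuum.HydrodynamicLimit.Theorems.HardSphereLDA
open Summit.AtomisticToContinuum.HydrodynamicLimit.Theorems.BlockGibbsLine

variable {a : T3 → ℝ} {n : ℕ}

/-! ## Monotonicity of the partition function in the diameter -/

/-- The position weight of a nonnegative activity is antitone in the diameter. [folklore] -/
theorem posWeight_antitone_diam (ha0 : ∀ y, 0 ≤ a y) {ε ε' : ℝ} (h : ε ≤ ε') (x : Fin n → T3) :
    posWeight a ε' n x ≤ posWeight a ε n x := by
  unfold posWeight
  exact indicator_le_indicator_of_subset (HsFreeEnergyConvex.posDomain_anti h n)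
    (fun y => Finset.prod_nonneg fun i _ => ha0 (y i)) x

/-- **The configurational partition function is antitone in the diameter**: `ε ≤ ε'` gives
`Z(a, ε', n) ≤ Z(a, ε, n)` (measurable activity `0 ≤ a ≤ A`). [cite: Ruelle1969, §3.4] -/
theorem posPartition_antitone_diam (ha : Measurable a) (ha0 : ∀ y, 0 ≤ a y) {A : ℝ} (hA : ∀ y, a y ≤ A)
    {ε ε' : ℝ} (h : ε ≤ ε') (n : ℕ) : posPartition a ε' n ≤ posPartition a ε n :=
  integral_mono (integrable_posWeight' ha ha0 hA ε' n) (integrable_posWeight' ha ha0 hA ε n)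
    fun x => posWeight_antitone_diam ha0 h x

/-! ## Comparison of activities -/

/-- **`Z` is `e^{nB}`-Lipschitz in `log a`**: for measurable activities `0 < a ≤ A`, `0 ≤ a'` with
`log a' − log a ≤ B` pointwise, `Z(a', ε, n) ≤ e^{nB} Z(a, ε, n)`. [folklore] -/
theorem posPartition_le_exp_mul_posPartition {a a' : T3 → ℝ} (ha : Measurable a) (ha0 : ∀ y, 0 < a y)
    {A : ℝ} (hA : ∀ y, a y ≤ A) (ha0' : ∀ y, 0 ≤ a' y) {B : ℝ}
    (hB : ∀ y, Real.log (a' y) - Real.log (a y) ≤ B) (ε : ℝ) (n : ℕ) :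
    posPartition a' ε n ≤ Real.exp (n * B) * posPartition a ε n := by
  -- `a' ≤ e^B a` pointwise
  have hle : ∀ y, a' y ≤ Real.exp B * a y := by
    intro y
    rcases (ha0' y).lt_or_eq with hpos | hzero
    · have h1 : Real.log (a' y) ≤ B + Real.log (a y) := by linarith [hB y]
      calc a' y = Real.exp (Real.log (a' y)) := (Real.exp_log hpos).symm
        _ ≤ Real.exp (B + Real.log (a y)) := Real.exp_le_exp.2 h1
        _ = Real.exp B * a y := by rw [Real.exp_add, Real.exp_log (ha0 y)]
    · rw [← hzero]; exact mul_nonneg (Real.exp_pos B).le (ha0 y).le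
  have hmono := posPartition_mono (a := a') (a' := fun y => Real.exp B * a y) (measurable_const.mul ha) ha0' hle
    (A := Real.exp B * A) (fun y => mul_le_mul_of_nonneg_left (hA y) (Real.exp_pos B).le) ε n
  -- `Z(e^B a) = e^{nB} Z(a)`
  have hscale : posPartition (fun y => Real.exp B * a y) ε n = Real.exp (n * B) * posPartition a ε n := by
    rw [posPartition, posPartition, ← integral_const_mul]
    refine integral_congr_ae (Eventually.of_forall fun x => ?_)
    unfold posWeight
    by_cases hx : x ∈ posDomain ε n
    · simp only [indicator_of_mem hx]
      rw [Finset.prod_mul_distrib, Finset.prod_const, Finset.card_univ, Fintype.card_fin, ← Real.exp_nat_mul]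
    · simp only [indicator_of_notMem hx, mul_zero]
  exact hmono.trans hscale.le

/-- **Two-sided form**: for measurable activities `0 < a ≤ A`, `0 < a' ≤ A'` with `|log a' − log a| ≤ B` and
`Z(a) > 0`: `Z(a') > 0` and `|log Z(a') − log Z(a)| ≤ nB`. [folklore] -/
theorem abs_log_posPartition_sub_log_posPartition_le {a a' : T3 → ℝ} (ha : Measurable a) (ha' : Measurable a')
    (ha0 : ∀ y, 0 < a y) (ha0' : ∀ y, 0 < a' y) {A A' : ℝ} (hA : ∀ y, a y ≤ A) (hA' : ∀ y, a' y ≤ A') {B : ℝ}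
    (hB : ∀ y, |Real.log (a' y) - Real.log (a y)| ≤ B) {ε : ℝ} {n : ℕ} (hZ : 0 < posPartition a ε n) :
    0 < posPartition a' ε n ∧
      |Real.log (posPartition a' ε n) - Real.log (posPartition a ε n)| ≤ n * B := by
  have h1 := posPartition_le_exp_mul_posPartition ha ha0 hA (fun y => (ha0' y).le)
    (fun y => (le_abs_self _).trans (hB y)) ε n
  have h2 := posPartition_le_exp_mul_posPartition ha' ha0' hA' (fun y => (ha0 y).le) (B := B)
    (fun y => by have h := hB y; rw [abs_sub_comm] at h; exact (le_abs_self _).trans h) ε n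
  have hZ' : 0 < posPartition a' ε n := by
    by_contra hc
    push Not at hc
    have : posPartition a ε n ≤ 0 :=
      h2.trans (mul_nonpos_of_nonneg_of_nonpos (Real.exp_pos _).le hc)
    linarith
  refine ⟨hZ', abs_le.2 ⟨?_, ?_⟩⟩
  · have h := Real.log_le_log hZ h2
    rw [Real.log_mul (Real.exp_pos _).ne' hZ'.ne', Real.log_exp] at h
    linarith
  · have h := Real.log_le_log hZ' h1
    rw [Real.log_mul (Real.exp_pos _).ne' hZ.ne', Real.log_exp] at h
    linarith

/-! ## The general family is squeezed between two conjunct families -/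

/-- **Eventually `σ₋ n_N^{-1/3} ≤ ε_N ≤ σ₊ n_N^{-1/3}`.** For an admissible family (`ε_N > 0`, `ε_N → 0`,
`n_N ε_N³ → σ³`, `σ > 0`) and `0 < σ₋ < σ < σ₊`, eventually in `N`: `n_N ≥ 1` and
`hsDiameter σ₋ (n_N − 1) ≤ ε_N ≤ hsDiameter σ₊ (n_N − 1)` (recall `hsDiameter σ' M = σ'(M+1)^{-1/3}`). [folklore] -/
theorem eventually_hsDiameter_le_le {σ : ℝ} (hσ : 0 < σ) {ε : ℕ → ℝ} {n : ℕ → ℕ} (hε : ∀ N, 0 < ε N)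
    (hε0 : Tendsto ε atTop (𝓝 0)) (hn : Tendsto (fun N => (n N : ℝ) * ε N ^ 3) atTop (𝓝 (σ ^ 3)))
    {σm σp : ℝ} (hσm : 0 < σm) (hmσ : σm < σ) (hσp : σ < σp) :
    ∀ᶠ N in atTop, 1 ≤ n N ∧ hsDiameter σm (n N - 1) ≤ ε N ∧ ε N ≤ hsDiameter σp (n N - 1) := by
  have hn1 : ∀ᶠ N in atTop, 1 ≤ n N :=
    (tendsto_atTop_of_tendsto_mul_pow_three hσ hε hε0 hn).eventually_ge_atTop 1
  have hm3 : σm ^ 3 < σ ^ 3 := pow_lt_pow_left₀ hmσ hσm.le (by norm_num)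
  have hp3 : σ ^ 3 < σp ^ 3 := pow_lt_pow_left₀ hσp hσ.le (by norm_num)
  have hlo : ∀ᶠ N in atTop, σm ^ 3 < (n N : ℝ) * ε N ^ 3 := hn (Ioi_mem_nhds hm3)
  have hhi : ∀ᶠ N in atTop, (n N : ℝ) * ε N ^ 3 < σp ^ 3 := hn (Iio_mem_nhds hp3)
  filter_upwards [hn1, hlo, hhi] with N hN h1 h2
  have hcast : (((n N - 1 + 1 : ℕ)) : ℝ) = n N := by rw [Nat.sub_add_cancel hN]
  have hnpos : (0 : ℝ) < n N := by exact_mod_cast hN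
  have hcube : ∀ σ' : ℝ, hsDiameter σ' (n N - 1) ^ 3 = σ' ^ 3 / n N := fun σ' => by
    rw [hsDiameter_pow_three, hcast]
  refine ⟨hN, ?_, ?_⟩
  · refine le_of_pow_le_pow_left₀ (by norm_num : (3 : ℕ) ≠ 0) (hε N).le ?_
    rw [hcube, div_le_iff₀ hnpos]
    linarith
  · refine le_of_pow_le_pow_left₀ (by norm_num : (3 : ℕ) ≠ 0) (hsDiameter_pos (hσ.trans hσp) _).le ?_
    rw [hcube, le_div_iff₀ hnpos]
    linarith

/-- Along an admissible family the conjunct index `n_N − 1` diverges, so conjunct-family limits pass to the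
subsequence `N ↦ n_N − 1`. [folklore] -/
theorem tendsto_comp_pred_of_tendsto {σ : ℝ} (hσ : 0 < σ) {ε : ℕ → ℝ} {n : ℕ → ℕ} (hε : ∀ N, 0 < ε N)
    (hε0 : Tendsto ε atTop (𝓝 0)) (hn : Tendsto (fun N => (n N : ℝ) * ε N ^ 3) atTop (𝓝 (σ ^ 3)))
    {f : ℕ → ℝ} {l : ℝ} (hf : Tendsto f atTop (𝓝 l)) :
    Tendsto (fun N => f (n N - 1)) atTop (𝓝 l) :=
  hf.comp ((tendsto_sub_atTop_nat 1).comp (tendsto_atTop_of_tendsto_mul_pow_three hσ hε hε0 hn))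

/-! ## The diameter sandwich -/

/-- **THE DIAMETER SANDWICH (conjunct-family free energies ⟹ general-family free energies).** Let `a_{σ'}`
(`σ'` real) be measurable activities on `𝕋³` with `0 < a_{σ'} ≤ A_{σ'}`, such that `log a_{σ'} → log a_σ`
uniformly as `σ' → σ`, and suppose that along the CONJUNCT family the free energies per particle converge,
`(N+1)⁻¹ log Z(a_{σ'}, hsDiameter σ' N, N+1) → L(σ')`, for every `σ'` in a neighbourhood of `σ ∈ (0, 1/2)`, with
`L` continuous at `σ`. Then for every admissible general family (`ε_N > 0`, `ε_N → 0`, `n_N ε_N³ → σ³`):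
`n_N⁻¹ log Z(a_σ, ε_N, n_N) → L(σ)`. Proof: squeeze `ε_N` between `σ± n_N^{-1/3}`
(`eventually_hsDiameter_le_le`), use antitonicity in the diameter and the `e^{nB}` activity comparison, read the
conjunct limits along `N ↦ n_N − 1`, and let `σ± → σ`. [cite: PulvirentiTsagkarogiannis2012, Thm 2.1] -/
theorem tendsto_log_posPartition_of_conjunct {σ : ℝ} (hσ : 0 < σ) (hσ2 : σ < 1 / 2)
    {ε : ℕ → ℝ} {n : ℕ → ℕ} (hε : ∀ N, 0 < ε N) (hε0 : Tendsto ε atTop (𝓝 0))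
    (hn : Tendsto (fun N => (n N : ℝ) * ε N ^ 3) atTop (𝓝 (σ ^ 3)))
    {δ : ℝ} (hδ : 0 < δ) {a : ℝ → T3 → ℝ} (ham : ∀ σ', |σ' - σ| < δ → Measurable (a σ'))
    (ha0 : ∀ σ', |σ' - σ| < δ → ∀ x, 0 < a σ' x) (hbdd : ∀ σ', |σ' - σ| < δ → ∃ A : ℝ, ∀ x, a σ' x ≤ A)
    (hact : ∀ e : ℝ, 0 < e → ∃ d : ℝ, 0 < d ∧ ∀ σ' : ℝ, |σ' - σ| < d →
      ∀ x, |Real.log (a σ' x) - Real.log (a σ x)| ≤ e)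
    {L : ℝ → ℝ} (hL : ContinuousAt L σ)
    (hlim : ∀ σ' : ℝ, |σ' - σ| < δ → Tendsto (fun N : ℕ => (((N + 1 : ℕ) : ℝ))⁻¹ *
        Real.log (posPartition (a σ') (hsDiameter σ' N) (N + 1))) atTop (𝓝 (L σ'))) :
    Tendsto (fun N => (n N : ℝ)⁻¹ * Real.log (posPartition (a σ) (ε N) (n N))) atTop (𝓝 (L σ)) := by
  rw [Metric.tendsto_atTop]
  intro e he
  have he3 : 0 < e / 3 := by positivity
  -- continuity of `L` and of the activities at `σ`
  obtain ⟨d₁, hd₁, hL₁⟩ : ∃ d₁ : ℝ, 0 < d₁ ∧ ∀ σ', |σ' - σ| < d₁ → |L σ' - L σ| < e / 3 := by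
    have h := Metric.continuousAt_iff.1 hL (e / 3) he3
    obtain ⟨d₁, hd₁, h⟩ := h
    exact ⟨d₁, hd₁, fun σ' hσ' => by
      have := h (show dist σ' σ < d₁ by rwa [Real.dist_eq]); rwa [Real.dist_eq] at this⟩
  obtain ⟨d₂, hd₂, hA₂⟩ := hact (e / 3) he3
  -- the two comparison diameters
  set d : ℝ := min (min δ d₁) (min d₂ (min σ (1 / 2 - σ))) / 2 with hd
  have hdpos : 0 < d := by
    rw [hd]; refine div_pos (lt_min (lt_min hδ hd₁) (lt_min hd₂ (lt_min hσ (by linarith)))) two_pos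
  have hdδ : d < δ := by
    have : min (min δ d₁) (min d₂ (min σ (1 / 2 - σ))) ≤ δ := (min_le_left _ _).trans (min_le_left _ _)
    rw [hd]; linarith
  have hdd₁ : d < d₁ := by
    have : min (min δ d₁) (min d₂ (min σ (1 / 2 - σ))) ≤ d₁ := (min_le_left _ _).trans (min_le_right _ _)
    rw [hd]; linarith
  have hdd₂ : d < d₂ := by
    have : min (min δ d₁) (min d₂ (min σ (1 / 2 - σ))) ≤ d₂ := (min_le_right _ _).trans (min_le_left _ _)
    rw [hd]; linarith
  have hdσ : d < σ := by
    have : min (min δ d₁) (min d₂ (min σ (1 / 2 - σ))) ≤ σ :=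
      (min_le_right _ _).trans ((min_le_right _ _).trans (min_le_left _ _))
    rw [hd]; linarith
  have hdhalf : d < 1 / 2 - σ := by
    have : min (min δ d₁) (min d₂ (min σ (1 / 2 - σ))) ≤ 1 / 2 - σ :=
      (min_le_right _ _).trans ((min_le_right _ _).trans (min_le_right _ _))
    rw [hd]; linarith
  set σp := σ + d with hσp
  set σm := σ - d with hσm
  have hσm0 : 0 < σm := by rw [hσm]; linarith
  have hmσ : σm < σ := by rw [hσm]; linarith
  have hσσp : σ < σp := by rw [hσp]; linarith
  have hσp2 : σp ≤ 1 / 2 := by rw [hσp]; linarith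
  have hσm2 : σm ≤ 1 / 2 := by linarith
  have habsp : |σp - σ| = d := by rw [hσp, add_sub_cancel_left, abs_of_pos hdpos]
  have habsm : |σm - σ| = d := by
    rw [hσm, show σ - d - σ = -d by ring, abs_neg, abs_of_pos hdpos]
  -- conjunct limits at `σ±`, along the subsequence `n_N - 1`
  have hlp := tendsto_comp_pred_of_tendsto hσ hε hε0 hn (hlim σp (by rw [habsp]; exact hdδ))
  have hlm := tendsto_comp_pred_of_tendsto hσ hε hε0 hn (hlim σm (by rw [habsm]; exact hdδ))
  rw [Metric.tendsto_atTop] at hlp hlm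
  obtain ⟨N₁, hN₁⟩ := hlp (e / 3) he3
  obtain ⟨N₂, hN₂⟩ := hlm (e / 3) he3
  obtain ⟨N₃, hN₃⟩ := eventually_atTop.1 (eventually_hsDiameter_le_le hσ hε hε0 hn hσm0 hmσ hσσp)
  refine ⟨max (max N₁ N₂) N₃, fun N hN => ?_⟩
  have hN1 : N₁ ≤ N := (le_max_left _ _).trans ((le_max_left _ _).trans hN)
  have hN2 : N₂ ≤ N := (le_max_right _ _).trans ((le_max_left _ _).trans hN)
  obtain ⟨hn1, hlo, hhi⟩ := hN₃ N ((le_max_right _ _).trans hN)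
  have hcastn : ((n N - 1 + 1 : ℕ) : ℝ) = n N := by rw [Nat.sub_add_cancel hn1]
  have hnn : n N - 1 + 1 = n N := Nat.sub_add_cancel hn1
  have hnpos : (0 : ℝ) < n N := by exact_mod_cast hn1
  -- bounds and positivity of the activities
  have hwσ : |σ - σ| < δ := by rw [sub_self, abs_zero]; exact hδ
  have hwp : |σp - σ| < δ := by rw [habsp]; exact hdδ
  have hwm : |σm - σ| < δ := by rw [habsm]; exact hdδ
  obtain ⟨Aσ, hAσ⟩ := hbdd σ hwσ
  obtain ⟨Ap, hAp⟩ := hbdd σp hwp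
  obtain ⟨Am, hAm⟩ := hbdd σm hwm
  have hBp : ∀ x, |Real.log (a σ x) - Real.log (a σp x)| ≤ e / 3 := fun x => by
    rw [abs_sub_comm]; exact hA₂ σp (by rw [habsp]; exact hdd₂) x
  have hBm : ∀ x, |Real.log (a σ x) - Real.log (a σm x)| ≤ e / 3 := fun x => by
    rw [abs_sub_comm]; exact hA₂ σm (by rw [habsm]; exact hdd₂) x
  -- the two conjunct partition functions at index `n_N - 1` are positive
  have hZp : 0 < posPartition (a σp) (hsDiameter σp (n N - 1)) (n N - 1 + 1) :=
    posPartition_pos' (ham σp hwp) (ha0 σp hwp) hAp hσp2 _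
  have hZm : 0 < posPartition (a σm) (hsDiameter σm (n N - 1)) (n N - 1 + 1) :=
    posPartition_pos' (ham σm hwm) (ha0 σm hwm) hAm hσm2 _
  rw [hnn] at hZp hZm
  -- activity comparison at the two conjunct diameters
  obtain ⟨hZp', hcmpP⟩ := abs_log_posPartition_sub_log_posPartition_le (ham σp hwp) (ham σ hwσ) (ha0 σp hwp)
    (ha0 σ hwσ) hAp hAσ hBp hZp
  obtain ⟨hZm', hcmpM⟩ := abs_log_posPartition_sub_log_posPartition_le (ham σm hwm) (ham σ hwσ) (ha0 σm hwm)
    (ha0 σ hwσ) hAm hAσ hBm hZm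
  -- diameter monotonicity
  have hmonoP : posPartition (a σ) (hsDiameter σp (n N - 1)) (n N) ≤ posPartition (a σ) (ε N) (n N) :=
    posPartition_antitone_diam (ham σ hwσ) (fun y => (ha0 σ hwσ y).le) hAσ hhi _
  have hmonoM : posPartition (a σ) (ε N) (n N) ≤ posPartition (a σ) (hsDiameter σm (n N - 1)) (n N) :=
    posPartition_antitone_diam (ham σ hwσ) (fun y => (ha0 σ hwσ y).le) hAσ hlo _
  have hZ : 0 < posPartition (a σ) (ε N) (n N) := hZp'.trans_le hmonoP
  have hlogP := Real.log_le_log hZp' hmonoP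
  have hlogM := Real.log_le_log hZ hmonoM
  -- the conjunct values at index `n_N - 1`
  have hvP := hN₁ N hN1
  have hvM := hN₂ N hN2
  rw [Real.dist_eq, hnn] at hvP hvM
  have hLp : |L σp - L σ| < e / 3 := hL₁ σp (by rw [habsp]; exact hdd₁)
  have hLm : |L σm - L σ| < e / 3 := hL₁ σm (by rw [habsm]; exact hdd₁)
  -- assemble
  rw [Real.dist_eq, abs_lt]
  have hcP := abs_le.1 hcmpP
  have hcM := abs_le.1 hcmpM
  have hvP' := abs_lt.1 hvP
  have hvM' := abs_lt.1 hvM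
  have hLp' := abs_lt.1 hLp
  have hLm' := abs_lt.1 hLm
  have hinv : (n N : ℝ)⁻¹ * (n N : ℝ) = 1 := inv_mul_cancel₀ hnpos.ne'
  constructor
  · -- lower bound through `σ₊`
    have h1 : (n N : ℝ)⁻¹ * Real.log (posPartition (a σp) (hsDiameter σp (n N - 1)) (n N)) - e / 3 ≤
        (n N : ℝ)⁻¹ * Real.log (posPartition (a σ) (ε N) (n N)) := by
      have h2 : Real.log (posPartition (a σp) (hsDiameter σp (n N - 1)) (n N)) - n N * (e / 3) ≤
          Real.log (posPartition (a σ) (ε N) (n N)) := by linarith [hcP.1]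
      have h3 := mul_le_mul_of_nonneg_left h2 (inv_nonneg.2 hnpos.le)
      have h4 : (n N : ℝ)⁻¹ * (Real.log (posPartition (a σp) (hsDiameter σp (n N - 1)) (n N)) - n N * (e / 3)) =
          (n N : ℝ)⁻¹ * Real.log (posPartition (a σp) (hsDiameter σp (n N - 1)) (n N)) - e / 3 := by
        rw [mul_sub, ← mul_assoc, hinv, one_mul]
      linarith [h3, h4]
    linarith [hvP'.1, hLp'.1]
  · -- upper bound through `σ₋`
    have h1 : (n N : ℝ)⁻¹ * Real.log (posPartition (a σ) (ε N) (n N)) ≤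
        (n N : ℝ)⁻¹ * Real.log (posPartition (a σm) (hsDiameter σm (n N - 1)) (n N)) + e / 3 := by
      have h2 : Real.log (posPartition (a σ) (ε N) (n N)) ≤
          Real.log (posPartition (a σm) (hsDiameter σm (n N - 1)) (n N)) + n N * (e / 3) := by linarith [hcM.2]
      have h3 := mul_le_mul_of_nonneg_left h2 (inv_nonneg.2 hnpos.le)
      have h4 : (n N : ℝ)⁻¹ * (Real.log (posPartition (a σm) (hsDiameter σm (n N - 1)) (n N)) + n N * (e / 3)) =
          (n N : ℝ)⁻¹ * Real.log (posPartition (a σm) (hsDiameter σm (n N - 1)) (n N)) + e / 3 := by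
        rw [mul_add, ← mul_assoc ((n N : ℝ)⁻¹) (n N) (e / 3), hinv, one_mul]
      linarith [h3, h4]
    linarith [hvM'.2, hLm'.2]

/-- **THE DIAMETER SANDWICH, registered form** (helper stub `generalFamilyFreeEnergySandwich` of crux
stmt-AtomisticToContinuum-12502, line `means-pin-entropy`; the statement of `tendsto_log_posPartition_of_conjunct`
as one closed proposition): conjunct-family free-energy limits near `σ`, for activities depending continuously on the
reduced diameter, give the free-energy limit along every admissible general family.
[cite: PulvirentiTsagkarogiannis2012, Thm 2.1] -/
theorem generalFamilyFreeEnergySandwich : ∀ {σ : ℝ}, 0 < σ → σ < 1 / 2 → ∀ {ε : ℕ → ℝ} {n : ℕ → ℕ}, (∀ N, 0 < ε N) → Filter.Tendsto ε Filter.atTop (nhds 0) → Filter.Tendsto (fun N => (n N : ℝ) * ε N ^ 3) Filter.atTop (nhds (σ ^ 3)) → ∀ {δ : ℝ}, 0 < δ → ∀ {a : ℝ → T3 → ℝ}, (∀ σ', |σ' - σ| < δ → Measurable (a σ')) → (∀ σ', |σ' - σ| < δ → ∀ x, 0 < a σ' x) → (∀ σ', |σ' - σ| < δ → ∃ A : ℝ,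 ∀ x, a σ' x ≤ A) → (∀ e : ℝ, 0 < e → ∃ d : ℝ, 0 < d ∧ ∀ σ' : ℝ, |σ' - σ| < d → ∀ x, |Real.log (a σ' x) - Real.log (a σ x)| ≤ e) → ∀ {L : ℝ → ℝ}, ContinuousAt L σ → (∀ σ' : ℝ, |σ' - σ| < δ → Filter.Tendsto (fun N : ℕ => (((N + 1 : ℕ) : ℝ))⁻¹ * Real.log (posPartition (a σ') (hsDiameter σ' N) (N + 1))) Filter.atTop (nhds (L σ'))) → Filter.Tendsto (fun N => (n N : ℝ)⁻¹ * Real.log (posPartition (a σ) (ε N) (n N))) Filter.atTop (nhds (L σ)) :=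
  fun hσ hσ2 _ _ hε hε0 hn _ hδ _ ham ha0 hbdd hact _ hL hlim =>
    tendsto_log_posPartition_of_conjunct hσ hσ2 hε hε0 hn hδ ham ha0 hbdd hact hL hlim

end Summit.AtomisticToContinuum.HydrodynamicLimit.Theorems.NearConstantShortTimeHL

end
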